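import Literature.NumberTheory.Automorphic.ResGLnArchCoefficientSignTwist
import Literature.Algebra.Homology.FiniteIndexCohomologySummand
import Literature.Algebra.Homology.ShapiroExplicit
import Mathlib.NumberTheory.NumberField.InfinitePlace.Embeddings
import HarnessLib

/-!
# The sign-twisted receptacles `H^q(GL_n(K), Fun(GL_n(𝔸_K^∞)/K_f(𝔫), E_λ ⊗ ε_S))` of `Res_{K/ℚ} GL_n`
# and their (injective, Hecke-equivariant) restriction to `H^q(S_{K_f(𝔫)}, Ẽ_λ) = levelCohomology`

Topic `NumberTheory/Automorphic`; namespaces `Literature.NumberTheory.Automorphic.TwistedQuotient`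
(generic part: restriction of the twisted cohomology to a subgroup of `Γ`) and
`Literature.NumberTheory.Automorphic.ResGLnCohomology`.  Definitions with bodies and theorems; no
named fact, no instance, no `sorry`.

WHY.  The Borel–Wallach comparison `H^•(Γ; E) ≅ H^•(𝔤, K; C^∞(Γ\G) ⊗ E)` [cite: BorelWallach2000,
VII 2.2, 2.5, 2.7] is a statement about a discrete subgroup `Γ` of a Lie group `G` with finitely
many connected components and its FULL maximal compact subgroup `K` (`X = G/K` is then Euclidean).
For `G = G_∞ = GL_n(K_∞)` and the tree's `(𝔤, K_∞)`-cohomology (`GKCohomology`, relative to the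
full `K_∞ = ∏ O(n) × ∏ U(n)`), the arithmetic groups are the `Γ_j ⊆ GL_n(K)` (NOT `GL_n(K)⁺`) and, by
Shapiro, the natural receptacle of the comparison with coefficients in a sign twist
`E_λ ⊗ ε_S` (`ResGLnCohomology.archCoeffRepSign`, whose restriction to `GL_n(K)` twists the Betti
coefficients `coeffRep` by the sign character `ε_S ∘ det`, `archCoeffRepSign_diagArch` below) is
`H^q(GL_n(K), Fun(GL_n(𝔸_K^∞)/K_f(𝔫), E_λ ⊗ ε_S))` — over the FULL `GL_n(K)`.  The tree's receptacle
`ResGLnCohomology.levelCohomology` (of the named fact `cuspidalEigenclass_exists`) is over `GL_n(K)⁺`,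
on which every `ε_S` is trivial; restriction along `GL_n(K)⁺ ≤ GL_n(K)` (finite index `≤ 2^{r₁}`,
invertible in `ℂ`) is injective and commutes with the double-coset operators, so that
`H^q(GL_n(K)⁺, Fun ⊗ E_λ) ⊇ ⊕_S H^q(GL_n(K), Fun ⊗ E_λ ⊗ ε_S)` Hecke-equivariantly (in fact `=`,
not proved here) [cite: GrobnerRaghuram2014, §6 Rem. 27, §7.1–7.2] [cite: Clozel1990, §3.5 (p. 122)].

WHAT (all proved):

* generic (`TwistedQuotient`, data `ι : Γ →* 𝒢`, `L ≤ 𝒢`, `ρ : Γ → GL(V)`, a subgroup `Δ ≤ Γ` and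
  `ρΔ : Δ → GL(V)` agreeing with `ρ` on `Δ`): `restrictHom` (the identity of `Fun(𝒢 ⧸ L, V)` as a
  morphism `Res_Δ Fun_ρ ⟶ Fun_{ρΔ}`), `restrictMap q : H^q(Γ, Fun_ρ) ⟶ H^q(Δ, Fun_{ρΔ})`
  (Mathlib `groupCohomology.map Δ.subtype`), `heckeOperator_comp_restrictMap` — **restriction
  commutes with every `T_g = [L g L]`** (`groupCohomology.map_comp`), and `restrictMap_injective` —
  **restriction is injective when `[Γ : Δ]` is finite and invertible in `k`**: it factors as
  `H^q(η) ≫ (Shapiro map) ≫ H^q(iso)` with `η : A ⟶ Coind_Δ^Γ Res_Δ A`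
  (`Literature.Algebra.Homology.map_coindUnit_injective`, transfer-free "`cores ∘ res = [Γ : Δ]`")
  and the explicit Shapiro isomorphism (`map_subtype_coindCounit_injective`)
  [cite: Brown1982CohomologyGroups, III (6.2), Prop. 9.5, Prop. 10.1];
* `ResGLnCohomology.signUnitsHom`, `glTotPos_eq_ker` — **`GL_n(K)⁺` is the kernel of the signs of
  `det` at the real embeddings**, hence of finite index (privately re-derived; the tree's public
  statement is `ResGLnCohomology.finiteIndex_glTotPos` of `ClozelAlgebraicityHeckeFieldResFiniteProofs`);
* `ResGLnCohomology.signDetK n K w`, `signCharK n K S = ε_S ∘ det : GL_n(K) →* ℂ`,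
  `signCharK_eq_signChar_diagArch` (it is the archimedean `ε_S` of `ResGLnArchCoefficientSignTwist` on
  `GL_n(K) ⊆ G_∞`), `signCharK_eq_one_of_mem` (trivial on `GL_n(K)⁺`);
* `ResGLnCohomology.coeffRepTwist n K λ S = E_λ(ℂ) ⊗ (ε_S ∘ det)` on `GL_n(K)`, `coeffRepTwist_apply`,
  `coeffRepTwist_coe` (`= coeffRepPos` on `GL_n(K)⁺`), `archCoeffRepSign_diagArch` — **the sign twist
  `E_λ ⊗ ε_S` of the archimedean coefficient module restricts on `GL_n(K)` to `coeffRepTwist`**;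
* `ResGLnCohomology.levelCohomologyTwist n K 𝔫 λ S q = H^q(GL_n(K), Fun(GL_n(𝔸_K^∞)/K_f(𝔫), E_λ ⊗ ε_S))`,
  its Hecke operators `heckeOpTwist`, `heckeTTwist` (same elements `BigHeckeGLn.heckeElement`), and
  `resTwist n K 𝔫 λ S q : levelCohomologyTwist … ⟶ levelCohomology ℂ n K 𝔫 λ q` with
  `resTwist_heckeOpTwist` / `resTwist_heckeTTwist` (**Hecke-equivariant**) and `resTwist_injective`
  (**injective**).

## Mathlib / Literature search

Mathlib: `groupCohomology.map / map_comp / map_congr / map_id / map_id_comp`, `Rep.res`, `Rep.ofHom`,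
`Subgroup.index_ker`, `Subgroup.finiteIndex_ker`, `NumberField.Embeddings` (`Fintype (K →+* ℝ)`),
`sign_eq_one_iff`.  Tree: `Literature.Algebra.Homology.coindUnit / map_coindUnit_injective /
eq_zero_of_index_smul_eq_zero` (`FiniteIndexCohomologySummand`), `coindCounit /
map_subtype_coindCounit_injective` (`ShapiroExplicit`), `TwistedQuotient.coeffRep / cohomology /
heckeRepHom / heckeOperator` (`CuspidalCohomologyGL`), `ResGLnCohomology.*` (`ResGLnCohomology`,
`ResGLnArchCoefficientModule`, `ResGLnArchCoefficientSignTwist`).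
`lean search 'restrictMap|levelCohomologyTwist|signCharK'`: nothing prior in `TwistedQuotient` /
`ResGLnCohomology` (the tree's `TwistedQuotientSubgroupModel` restricts the ADELIC variable, not `Γ`).

## References

* A. Borel, N. Wallach, *Continuous cohomology, discrete subgroups, and representations of reductive
  groups*, 2nd ed. (2000), VII 2.2, 2.5, 2.7. [BorelWallach2000]
* K. S. Brown, *Cohomology of Groups*, GTM 87 (1982), III (6.2), Prop. 9.5, Prop. 10.1.
  [Brown1982CohomologyGroups]
* H. Grobner, A. Raghuram, Int. J. Number Theory 10 (2014) = arXiv:1102.1872, §6 Rem. 27, §7.1–7.2.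
  [GrobnerRaghuram2014]
* L. Clozel, *Motifs et formes automorphes* (1990), Lemme 3.14, §3.5 (p. 122). [Clozel1990]
-/

noncomputable section

open CategoryTheory groupCohomology

universe u

namespace Literature.NumberTheory.Automorphic

/-! ### Restriction of `H^q(Γ, Fun(𝒢 ⧸ L, V))` to a subgroup `Δ ≤ Γ` -/

namespace TwistedQuotient

section Restrict

variable {k : Type u} [CommRing k] {Γ 𝒢 : Type u} [Group Γ] [Group 𝒢]
  (ι : Γ →* 𝒢) (L : Subgroup 𝒢) {V : Type u} [AddCommGroup V] [Module k V]
  (ρ : Representation k Γ V) (Δ : Subgroup Γ) (ρΔ : Representation k Δ V)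
  (hρ : ∀ δ : Δ, ρΔ δ = ρ (δ : Γ))

/-- The identity of `Fun(𝒢 ⧸ L, V)` as a morphism of `Δ`-representations
`Res_Δ Fun(𝒢 ⧸ L, V)_ρ ⟶ Fun(𝒢 ⧸ L, V)_{ρΔ}` (`ρΔ = ρ` on `Δ`, `ι ∘ (Δ ≤ Γ)` the embedding of `Δ`).
[folklore] -/
def restrictHom :
    Rep.res Δ.subtype (coeffRep ι L ρ) ⟶ coeffRep (ι.comp Δ.subtype) L ρΔ :=
  Rep.ofHom ⟨LinearMap.id, fun δ => LinearMap.ext fun f => funext fun c => by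
    simp only [LinearMap.coe_comp, Function.comp_apply, LinearMap.id_coe, id_eq,
      MonoidHom.coe_comp, Subgroup.coe_subtype, coeffRepresentation_apply, hρ]⟩

/-- Unfolding: `restrictHom` is the identity on functions. [folklore] -/
@[simp]
theorem restrictHom_hom_apply (f : (𝒢 ⧸ L) → V) : (restrictHom ι L ρ Δ ρΔ hρ).hom f = f := rfl

/-- **Restriction `H^q(Γ, Fun(𝒢 ⧸ L, V)_ρ) ⟶ H^q(Δ, Fun(𝒢 ⧸ L, V)_{ρΔ})`** along `Δ ≤ Γ`
(Mathlib `groupCohomology.map Δ.subtype`). [cite: Brown1982CohomologyGroups, III §9] -/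
def restrictMap (q : ℕ) : cohomology ι L ρ q ⟶ cohomology (ι.comp Δ.subtype) L ρΔ q :=
  groupCohomology.map Δ.subtype (restrictHom ι L ρ Δ ρΔ hρ) q

/-- **Restriction commutes with the double-coset operators `T_g = [L g L]`.** [folklore] -/
theorem heckeOperator_comp_restrictMap (g : 𝒢) (q : ℕ) :
    heckeOperator ι L ρ g q ≫ restrictMap ι L ρ Δ ρΔ hρ q =
      restrictMap ι L ρ Δ ρΔ hρ q ≫ heckeOperator (ι.comp Δ.subtype) L ρΔ g q := by
  simp only [heckeOperator, restrictMap]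
  rw [← groupCohomology.map_comp, ← groupCohomology.map_comp]
  exact groupCohomology.map_congr (by ext; rfl) (LinearMap.ext fun f => rfl) q

/-- The same on elements, for the `k`-linear `heckeEnd`. [folklore] -/
theorem restrictMap_heckeEnd_apply (g : 𝒢) (q : ℕ) (x : cohomology ι L ρ q) :
    (restrictMap ι L ρ Δ ρΔ hρ q).hom (heckeEnd ι L ρ g q x) =
      heckeEnd (ι.comp Δ.subtype) L ρΔ g q ((restrictMap ι L ρ Δ ρΔ hρ q).hom x) := by
  have h := LinearMap.congr_fun (congrArg ModuleCat.Hom.hom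
    (heckeOperator_comp_restrictMap ι L ρ Δ ρΔ hρ g q)) x
  rw [ModuleCat.hom_comp, ModuleCat.hom_comp, LinearMap.comp_apply, LinearMap.comp_apply] at h
  exact h

/-- **Restriction to a subgroup of finite index invertible in `k` is injective** on
`H^q(Γ, Fun(𝒢 ⧸ L, V))`: it is `H^q(η) ≫ Ψ ≫ H^q(iso)` with `η : A ⟶ Coind_Δ^Γ Res_Δ A` injective on
cohomology (transfer-free `cores ∘ res = [Γ : Δ]`, `Literature.Algebra.Homology.map_coindUnit_injective`),
`Ψ` the explicit Shapiro isomorphism (`map_subtype_coindCounit_injective`) and the isomorphism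
`Res_Δ Fun_ρ ≅ Fun_{ρΔ}`. [cite: Brown1982CohomologyGroups, III (6.2), Prop. 9.5, Prop. 10.1] -/
theorem restrictMap_injective [Δ.FiniteIndex] (hunit : IsUnit ((Δ.index : ℕ) : k)) (q : ℕ) :
    Function.Injective (restrictMap ι L ρ Δ ρΔ hρ q).hom := by
  -- notation
  let A : Rep k Γ := coeffRep ι L ρ
  let B : Rep k Δ := coeffRep (ι.comp Δ.subtype) L ρΔ
  let φ : Rep.res Δ.subtype A ⟶ B := restrictHom ι L ρ Δ ρΔ hρ
  -- the inverse identity `B ⟶ Res_Δ A`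
  let ψ : B ⟶ Rep.res Δ.subtype A :=
    Rep.ofHom ⟨LinearMap.id, fun δ => LinearMap.ext fun f => funext fun c => by
      simp only [LinearMap.coe_comp, Function.comp_apply, LinearMap.id_coe, id_eq,
        MonoidHom.coe_comp, Subgroup.coe_subtype, coeffRepresentation_apply, hρ, A]⟩
  have hφψ : φ ≫ ψ = 𝟙 _ := Rep.hom_ext (Representation.IntertwiningMap.ext (LinearMap.ext fun f => rfl))
  -- (1) `map Δ.subtype φ = map Δ.subtype (𝟙) ≫ map id φ`
  have h1 : groupCohomology.map Δ.subtype φ q =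
      groupCohomology.map Δ.subtype (𝟙 (Rep.res Δ.subtype A)) q ≫
        groupCohomology.map (MonoidHom.id Δ) (A := Rep.res Δ.subtype A) (B := B) φ q := by
    rw [← groupCohomology.map_comp]
    exact groupCohomology.map_congr (by ext; rfl) (LinearMap.ext fun f => rfl) q
  -- (2) `map id φ` is injective (left inverse `map id ψ`)
  have h2 : Function.Injective
      (groupCohomology.map (MonoidHom.id Δ) (A := Rep.res Δ.subtype A) (B := B) φ q).hom := by
    intro x y hxy
    have h := congrArg (groupCohomology.map (MonoidHom.id Δ) (A := B) (B := Rep.res Δ.subtype A) ψ q).hom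
      hxy
    have hcomp : groupCohomology.map (MonoidHom.id Δ) (A := Rep.res Δ.subtype A) (B := B) φ q ≫
        groupCohomology.map (MonoidHom.id Δ) (A := B) (B := Rep.res Δ.subtype A) ψ q = 𝟙 _ := by
      rw [← groupCohomology.map_id_comp, hφψ, groupCohomology.map_id]
    have hc := fun z => LinearMap.congr_fun (congrArg ModuleCat.Hom.hom hcomp) z
    simp only [ModuleCat.hom_comp, LinearMap.comp_apply, ModuleCat.hom_id, LinearMap.id_apply] at hc
    rwa [hc, hc] at h
  -- (3) `map Δ.subtype (𝟙) = map id η ≫ Ψ` with `η` the unit and `Ψ` the Shapiro map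
  have h3 : groupCohomology.map Δ.subtype (𝟙 (Rep.res Δ.subtype A)) q =
      groupCohomology.map (MonoidHom.id Γ) (A := A)
          (B := Rep.coind Δ.subtype (Rep.res Δ.subtype A)) (Literature.Algebra.Homology.coindUnit Δ A) q ≫
        groupCohomology.map Δ.subtype
          (Literature.Algebra.Homology.coindCounit Δ (Rep.res Δ.subtype A)) q := by
    rw [← groupCohomology.map_comp]
    refine groupCohomology.map_congr (by ext; rfl) (LinearMap.ext fun f => ?_) q
    change f = ((Literature.Algebra.Homology.coindUnit Δ A).hom f :
      Rep.coind Δ.subtype (Rep.res Δ.subtype A)).1 1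
    rw [Literature.Algebra.Homology.coindUnit_hom_apply_coe, map_one]
    rfl
  have h4 : Function.Injective (groupCohomology.map Δ.subtype (𝟙 (Rep.res Δ.subtype A)) q).hom := by
    rw [h3, ModuleCat.hom_comp]
    exact (Literature.Algebra.Homology.map_subtype_coindCounit_injective Δ (Rep.res Δ.subtype A) q).comp
      (Literature.Algebra.Homology.map_coindUnit_injective Δ A q fun x hx =>
        Literature.Algebra.Homology.eq_zero_of_index_smul_eq_zero Δ hunit x hx)
  -- assemble
  change Function.Injective (groupCohomology.map Δ.subtype φ q).hom
  rw [h1, ModuleCat.hom_comp]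
  exact h2.comp h4

end Restrict

end TwistedQuotient

/-! ### `GL_n(K)⁺` has finite index: the sign map -/

namespace ResGLnCohomology

open RealMatrixGroup ParallelWeight _root_.NumberField _root_.NumberField.InfinitePlace
open scoped MatrixGroups Classical

section Signs

variable (n : ℕ) (K : Type) [Field K]

/-- The signs of `det g` at the real embeddings, as a homomorphism
`GL_n(K) →* ((K →+* ℝ) → SignTypeˣ)`. [folklore] -/
def signUnitsHom : GL (Fin n) K →* ((K →+* ℝ) → SignTypeˣ) :=
  MonoidHom.pi fun τ : K →+* ℝ =>
    (Units.map (signHom : ℝ →*₀ SignType).toMonoidHom).comp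
      ((Units.map (τ : K →* ℝ)).comp Matrix.GeneralLinearGroup.det)

/-- Unfolding: the `τ`-component of `signUnitsHom g` is `sgn(τ(det g))`. [folklore] -/
theorem signUnitsHom_apply_coe (g : GL (Fin n) K) (τ : K →+* ℝ) :
    ((signUnitsHom n K g τ : SignTypeˣ) : SignType) =
      SignType.sign (τ ((Matrix.GeneralLinearGroup.det g : Kˣ) : K)) :=
  rfl

/-- **`GL_n(K)⁺` is the kernel of the sign map.** [folklore] -/
theorem glTotPos_eq_ker : glTotPos n K = (signUnitsHom n K).ker := by
  refine Subgroup.ext fun g => ?_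
  rw [mem_glTotPos_iff, MonoidHom.mem_ker, funext_iff]
  refine forall_congr' fun τ => ?_
  rw [Pi.one_apply, ← Units.val_inj, signUnitsHom_apply_coe, Units.val_one, sign_eq_one_iff]

/-! ### The sign characters `ε_S ∘ det` of `GL_n(K)` and the twisted Betti coefficients -/

/-- The sign of `det g` at the real place `w`, as a character `GL_n(K) →* ℂ`. [folklore] -/
def signDetK (w : {w : InfinitePlace K // w.IsReal}) : GL (Fin n) K →* ℂ :=
  SignType.castHom.toMonoidHom.comp <|
    (signHom : ℝ →*₀ SignType).toMonoidHom.comp <|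
      (Units.coeHom ℝ).comp <|
        (Units.map (embedding_of_isReal w.2 : K →* ℝ)).comp Matrix.GeneralLinearGroup.det

/-- Unfolding: `signDetK n K w g = sgn(w(det g))`. [folklore] -/
theorem signDetK_apply (w : {w : InfinitePlace K // w.IsReal}) (g : GL (Fin n) K) :
    signDetK n K w g =
      ((SignType.sign (embedding_of_isReal w.2 ((Matrix.GeneralLinearGroup.det g : Kˣ) : K)) :
        SignType) : ℂ) :=
  rfl

/-- **The sign character `ε_S ∘ det = ∏_{w ∈ S} sgn(w(det ·))` of `GL_n(K)`** attached to a set `S`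
of real places. [cite: GrobnerRaghuram2014, §6 Rem. 27] -/
def signCharK (S : Finset {w : InfinitePlace K // w.IsReal}) : GL (Fin n) K →* ℂ :=
  ∏ w ∈ S, signDetK n K w

variable (S : Finset {w : InfinitePlace K // w.IsReal})

/-- Unfolding. [folklore] -/
theorem signCharK_apply (g : GL (Fin n) K) : signCharK n K S g = ∏ w ∈ S, signDetK n K w g := by
  rw [signCharK, MonoidHom.finsetProd_apply]

/-- **`ε_S ∘ det = 1` on `GL_n(K)⁺`** (a totally positive determinant has sign `+1` at every real
place). [folklore] -/
theorem signCharK_eq_one_of_mem {γ : GL (Fin n) K} (hγ : γ ∈ glTotPos n K) : signCharK n K S γ = 1 := by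
  rw [signCharK_apply]
  refine Finset.prod_eq_one fun w _ => ?_
  rw [signDetK_apply, sign_pos ((mem_glTotPos_iff γ).1 hγ (embedding_of_isReal w.2))]
  rfl

variable (lam : (K →+* ℂ) → Fin n → ℤ)

/-- **The twisted Betti coefficients `E_λ(ℂ) ⊗ (ε_S ∘ det)` of `GL_n(K)`**: `g ↦ ε_S(det g) E_λ(g)` on
`ResGLnCohomology.CoeffModule ℂ n K λ`. [cite: GrobnerRaghuram2014, §6 Rem. 27, §7.1] -/
def coeffRepTwist : Representation ℂ (GL (Fin n) K) (CoeffModule ℂ n K lam) where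
  toFun g := signCharK n K S g • coeffRep ℂ n K lam g
  map_one' := by rw [map_one, map_one, one_smul]
  map_mul' g g' := by
    refine LinearMap.ext fun v => ?_
    simp only [map_mul, LinearMap.smul_apply, Module.End.mul_apply, map_smul, smul_smul,
      mul_comm (signCharK n K S g') (signCharK n K S g)]

/-- Unfolding. [folklore] -/
@[simp]
theorem coeffRepTwist_apply (g : GL (Fin n) K) (v : CoeffModule ℂ n K lam) :
    coeffRepTwist n K S lam g v = signCharK n K S g • coeffRep ℂ n K lam g v :=
  rfl

/-- **On `GL_n(K)⁺` the twisted coefficients are `coeffRepPos`** (the coefficients of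
`levelCohomology`). [folklore] -/
theorem coeffRepTwist_coe (γ : glTotPos n K) :
    coeffRepTwist n K S lam (γ : GL (Fin n) K) = coeffRepPos ℂ n K lam γ := by
  refine LinearMap.ext fun v => ?_
  rw [coeffRepTwist_apply, signCharK_eq_one_of_mem n K S γ.2, one_smul, coeffRepPos_apply]

variable [NumberField K]

/-- **`GL_n(K)⁺ ≤ GL_n(K)` has finite index** (at most `2^{r₁}`; the kernel of a homomorphism to a
finite group).  The tree's public statement is `ResGLnCohomology.finiteIndex_glTotPos` of
`ClozelAlgebraicityHeckeFieldResFiniteProofs` (via `GL_n(ℝ)⁺`); this private copy through the sign map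
keeps the import closure of this file small. [folklore] -/
private theorem finiteIndex_glTotPos_of_ker : (glTotPos n K).FiniteIndex := by
  rw [glTotPos_eq_ker]
  infer_instance

/-- `signDetK` is the archimedean `signDetChar` at `w` on `GL_n(K) ⊆ G_∞`
(`ResGLnCohomology.signDetChar_diagArch`). [folklore] -/
theorem signDetK_eq_signDetChar_diagArch (w : {w : InfinitePlace K // w.IsReal}) (g : GL (Fin n) K) :
    signDetK n K w g = signDetChar (archGroupGL n K) (mixedSpaceEvalReal K w) (diagArch K n g) := by
  rw [signDetChar_diagArch, signDetK_apply]

/-- **`ε_S ∘ det` on `GL_n(K)` is the archimedean `ε_S` of `ResGLnArchCoefficientSignTwist` on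
`GL_n(K) ⊆ G_∞`.** [folklore] -/
theorem signCharK_eq_signChar_diagArch (g : GL (Fin n) K) :
    signCharK n K S g = signChar n K S (diagArch K n g) := by
  rw [signCharK_apply, signChar_apply]
  exact Finset.prod_congr rfl fun w _ => signDetK_eq_signDetChar_diagArch n K w g

/-- **The sign twist `E_λ ⊗ ε_S` of the archimedean coefficient module restricts on `GL_n(K) ⊆ G_∞` to
the twisted Betti coefficients `coeffRepTwist`** (`archCoeffRep_diagArch` and
`signCharK_eq_signChar_diagArch`). [cite: BorelWallach2000, VII 2.7] [cite: GrobnerRaghuram2014, §7.1] -/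
theorem archCoeffRepSign_diagArch (g : GL (Fin n) K) :
    archCoeffRepSign n K S lam (diagArch K n g) = coeffRepTwist n K S lam g := by
  refine LinearMap.ext fun v => ?_
  rw [archCoeffRepSign_apply, coeffRepTwist_apply, signCharK_eq_signChar_diagArch, archCoeffRep_diagArch]

end Signs

/-! ### `H^q(GL_n(K), Fun(GL_n(𝔸_K^∞)/K_f(𝔫), E_λ ⊗ ε_S))` and its restriction to `levelCohomology` -/

section Receptacle

variable (n : ℕ) (K : Type) [Field K] [NumberField K] (𝔫 : Ideal (𝓞 K))
  (lam : (K →+* ℂ) → Fin n → ℤ) (S : Finset {w : InfinitePlace K // w.IsReal})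

/-- **`H^q(GL_n(K), Fun(GL_n(𝔸_K^∞)/K_f(𝔫), E_λ(ℂ) ⊗ ε_S))`** — the twisted cohomology over the FULL
`GL_n(K)` with the sign-twisted coefficients: by Shapiro the direct sum over the cusps
`g_j ∈ GL_n(K)\GL_n(𝔸_K^∞)/K_f(𝔫)` of `H^q(Γ_j, E_λ ⊗ ε_S)`, `Γ_j = GL_n(K) ∩ g_j K_f(𝔫) g_j⁻¹`, the
left-hand side of Borel–Wallach's `H^q(Γ; E) ≅ H^q(𝔤, K_∞; C^∞(Γ\G_∞) ⊗ E)` for the full maximal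
compact `K_∞`. [cite: BorelWallach2000, VII 2.2, 2.7] [cite: GrobnerRaghuram2014, §7.1–7.2] -/
abbrev levelCohomologyTwist (q : ℕ) : ModuleCat ℂ :=
  TwistedQuotient.cohomology (V := CoeffModule ℂ n K lam) (BigHeckeGLn.globalEmbedding n K)
    (level n K 𝔫) (coeffRepTwist n K S lam) q

/-- The Hecke operator `T_g = [K_f(𝔫) g K_f(𝔫)]` on the twisted receptacle. [folklore] -/
abbrev heckeOpTwist (q : ℕ) (g : BigHeckeGLn.FiniteAdelicGL n K) :
    Module.End ℂ (levelCohomologyTwist n K 𝔫 lam S q) :=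
  TwistedQuotient.heckeEnd (V := CoeffModule ℂ n K lam) (BigHeckeGLn.globalEmbedding n K)
    (level n K 𝔫) (coeffRepTwist n K S lam) g q

/-- **`T_{v,i} = [K_f(𝔫) t_{v,i} K_f(𝔫)]`** on the twisted receptacle, with the same elements
`BigHeckeGLn.heckeElement n K v i` as `ResGLnCohomology.heckeT`. [cite: Clozel1990, §3.5 (p. 123)] -/
abbrev heckeTTwist (q : ℕ) (v : IsDedekindDomain.HeightOneSpectrum (𝓞 K)) (i : ℕ) :
    Module.End ℂ (levelCohomologyTwist n K 𝔫 lam S q) :=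
  heckeOpTwist n K 𝔫 lam S q (BigHeckeGLn.heckeElement n K v i)

/-- **Restriction `H^q(GL_n(K), Fun ⊗ E_λ ⊗ ε_S) ⟶ H^q(GL_n(K)⁺, Fun ⊗ E_λ) = levelCohomology ℂ n K 𝔫 λ q`**
along `GL_n(K)⁺ ≤ GL_n(K)` (`ε_S = 1` there). [cite: GrobnerRaghuram2014, §7.1–7.2] -/
def resTwist (q : ℕ) : levelCohomologyTwist n K 𝔫 lam S q ⟶ levelCohomology ℂ n K 𝔫 lam q :=
  TwistedQuotient.restrictMap (BigHeckeGLn.globalEmbedding n K) (level n K 𝔫) (coeffRepTwist n K S lam)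
    (glTotPos n K) (coeffRepPos ℂ n K lam) (fun γ => (coeffRepTwist_coe n K S lam γ).symm) q

/-- **Restriction is Hecke-equivariant**: `res (T_g x) = T_g (res x)` for every `g ∈ GL_n(𝔸_K^∞)`.
[folklore] -/
theorem resTwist_heckeOpTwist (q : ℕ) (g : BigHeckeGLn.FiniteAdelicGL n K)
    (x : levelCohomologyTwist n K 𝔫 lam S q) :
    (resTwist n K 𝔫 lam S q).hom (heckeOpTwist n K 𝔫 lam S q g x) =
      heckeOp ℂ n K 𝔫 lam q g ((resTwist n K 𝔫 lam S q).hom x) :=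
  TwistedQuotient.restrictMap_heckeEnd_apply _ _ _ _ _ _ g q x

/-- In particular for the `T_{v,i}`. [folklore] -/
theorem resTwist_heckeTTwist (q : ℕ) (v : IsDedekindDomain.HeightOneSpectrum (𝓞 K)) (i : ℕ)
    (x : levelCohomologyTwist n K 𝔫 lam S q) :
    (resTwist n K 𝔫 lam S q).hom (heckeTTwist n K 𝔫 lam S q v i x) =
      heckeT ℂ n K 𝔫 lam q v i ((resTwist n K 𝔫 lam S q).hom x) :=
  resTwist_heckeOpTwist n K 𝔫 lam S q _ x

/-- **Restriction to `levelCohomology` is injective** (`[GL_n(K) : GL_n(K)⁺] ≤ 2^{r₁}` is invertible in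
`ℂ`). [cite: Brown1982CohomologyGroups, III Prop. 10.1] -/
theorem resTwist_injective (q : ℕ) : Function.Injective (resTwist n K 𝔫 lam S q).hom := by
  haveI := finiteIndex_glTotPos_of_ker n K
  exact TwistedQuotient.restrictMap_injective _ _ _ _ _ _
    (isUnit_iff_ne_zero.2 (Nat.cast_ne_zero.2 Subgroup.FiniteIndex.index_ne_zero)) q

end Receptacle

end ResGLnCohomology

end Literature.NumberTheory.Automorphic

end
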